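import Mathlib
import HarnessLib

/-!
# Stub `stub_windowDomination` of line `Sketch` (idea `return-flow-bernstein`)
(crux `CageBudgetFekete.QuasiSuperadditiveHeatVariance`, item stmt-AtomisticToContinuum-15769; `--supports` file,
closes nothing)

WHAT. The registered stub A1 of the crux's skeleton
(`Cruxes/QuasiSuperadditiveHeatVariance/Lines/Sketch.lean`): for continuous `C, K : ℝ → ℝ` with `-K t ≤ C t` for
`t ≥ 0` and the Einstein–Helfand heat variance `V(τ) = 2∫_{(0,τ]} (τ - s) C(s) ds`, for all `s, t ≥ 0`,
`V s + V t ≤ V (s + t) + 2 ∫₀ˢ (∫ᵤ^{u+t} K) du` — WINDOW DOMINATION: `V` is superadditive up to the doubly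
integrated minorant kernel.

HOW. Pure real analysis (Mathlib's interval integral and FTC). With `F` and `G` the primitives of `C` and of
`x ↦ x C(x)` (`Continuous.integral_hasStrictDerivAt`), `V = W := 2 (τ F - G)` on `[0, ∞)` and `W' = 2F`; FTC-2
(`intervalIntegral.integral_eq_sub_of_hasDerivAt`) applied to `u ↦ W (u + t) - W u` on `[0, s]` gives the
adjacent-window identity `W (s + t) - W s - W t = 2 ∫₀ˢ (F (u + t) - F u) du = 2 ∫₀ˢ ∫ᵤ^{u+t} C`, and the pointwise
window domination `-∫ᵤ^{u+t} K ≤ ∫ᵤ^{u+t} C` (`u, t ≥ 0`, `intervalIntegral.integral_mono_on`) is integrated once more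
over `u ∈ [0, s]` (the sliding-window integrals are continuous in `u`, being differences of primitives).

NOT here: the Bernstein-kernel budget (stub A2) and the physical return-flow domination (stub P) of the same line.
-/

noncomputable section

namespace Summit.AtomisticToContinuum.FouriersLaw.Theorems.QuasiSuperadditiveHeatVariance.ReturnFlowBernstein

open MeasureTheory Filter Set intervalIntegral
open scoped Topology

/-- Sliding-window integral of a continuous function as a difference of values of its primitive:
`∫ᵤ^{u+t} f = ∫₀^{u+t} f - ∫₀^u f`. [folklore] -/
theorem window_integral_eq_primitive_sub {f : ℝ → ℝ} (hf : Continuous f) (u t : ℝ) :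
    ∫ w in u..(u + t), f w = (∫ w in (0:ℝ)..(u + t), f w) - ∫ w in (0:ℝ)..u, f w :=
  (intervalIntegral.integral_interval_sub_left (hf.intervalIntegrable _ _) (hf.intervalIntegrable _ _)).symm

/-- The sliding-window integral `u ↦ ∫ᵤ^{u+t} f` of a continuous function is continuous in the window
position `u`. [folklore] -/
theorem continuous_window_integral {f : ℝ → ℝ} (hf : Continuous f) (t : ℝ) :
    Continuous fun u : ℝ => ∫ w in u..(u + t), f w := by
  have hF : Continuous fun v : ℝ => ∫ w in (0:ℝ)..v, f w :=
    continuous_iff_continuousAt.2 fun v => (hf.integral_hasStrictDerivAt 0 v).hasDerivAt.continuousAt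
  have e : (fun u : ℝ => ∫ w in u..(u + t), f w) =
      fun u : ℝ => (∫ w in (0:ℝ)..(u + t), f w) - ∫ w in (0:ℝ)..u, f w :=
    funext fun u => window_integral_eq_primitive_sub hf u t
  rw [e]
  exact (hF.comp (continuous_add_const t)).sub hF

/-- Pointwise window domination: if `-K ≤ C` on `[0, ∞)` (both continuous) then `-∫ᵤ^{u+t} K ≤ ∫ᵤ^{u+t} C`
for all `u, t ≥ 0`. [folklore] -/
theorem neg_window_integral_le {C K : ℝ → ℝ} (hC : Continuous C) (hK : Continuous K)
    (hdom : ∀ t : ℝ, 0 ≤ t → -K t ≤ C t) {u t : ℝ} (hu : 0 ≤ u) (ht : 0 ≤ t) :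
    -(∫ w in u..(u + t), K w) ≤ ∫ w in u..(u + t), C w := by
  rw [← intervalIntegral.integral_neg]
  exact intervalIntegral.integral_mono_on (le_add_of_nonneg_right ht) (hK.neg.intervalIntegrable _ _)
    (hC.intervalIntegrable _ _) fun w hw => hdom w (hu.trans hw.1)

/-- **Stub `stub_windowDomination` (registered signature, verbatim): window domination for the
Einstein–Helfand heat variance.** For continuous `C, K : ℝ → ℝ` with `-K t ≤ C t` for `t ≥ 0` and
`V(τ) = 2∫_{(0,τ]} (τ - s) C(s) ds`: for all `s, t ≥ 0`,
`V s + V t ≤ V (s + t) + 2 ∫₀ˢ (∫ᵤ^{u+t} K(w) dw) du`.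
Proof: `V = 2(τF - G)` on `[0, ∞)` (`F, G` the primitives of `C`, `x C(x)`), adjacent-window identity
`V (s + t) - V s - V t = 2 ∫₀ˢ ∫ᵤ^{u+t} C` (FTC), and `∫ᵤ^{u+t} C ≥ -∫ᵤ^{u+t} K` for `u ≥ 0`. [folklore] -/
theorem stub_windowDomination :
    ∀ C K : ℝ → ℝ, Continuous C → Continuous K → (∀ t : ℝ, 0 ≤ t → -K t ≤ C t) →
    ∀ V : ℝ → ℝ, V = (fun τ : ℝ => 2 * ∫ s in Set.Ioc (0:ℝ) τ, (τ - s) * C s) →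
    ∀ s t : ℝ, 0 ≤ s → 0 ≤ t →
      V s + V t ≤ V (s + t) + 2 * ∫ u in (0:ℝ)..s, ∫ w in u..(u + t), K w := by
  intro C K hC hK hdom V hV s t hs ht
  -- the primitives of `C` and of `x ↦ x * C x`, and the closed form `W` of `V` on `[0, ∞)`
  set F : ℝ → ℝ := fun v => ∫ x in (0:ℝ)..v, C x
  set G : ℝ → ℝ := fun v => ∫ x in (0:ℝ)..v, x * C x with hG
  set W : ℝ → ℝ := fun v => 2 * (v * F v - G v) with hW
  have hxC : Continuous fun x : ℝ => x * C x := continuous_id.mul hC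
  have hFd : ∀ v : ℝ, HasDerivAt F (C v) v := fun v => (hC.integral_hasStrictDerivAt 0 v).hasDerivAt
  have hGd : ∀ v : ℝ, HasDerivAt G (v * C v) v := fun v => (hxC.integral_hasStrictDerivAt 0 v).hasDerivAt
  have hWd : ∀ v : ℝ, HasDerivAt W (2 * F v) v := fun v =>
    ((((hasDerivAt_id' v).mul (hFd v)).sub (hGd v)).const_mul (2:ℝ)).congr_deriv (by ring)
  have hFc : Continuous F := continuous_iff_continuousAt.2 fun v => (hFd v).continuousAt
  have hW0 : W 0 = 0 := by simp [hW, hG]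
  -- `V = W` on `[0, ∞)`
  have hVW : ∀ τ : ℝ, 0 ≤ τ → V τ = W τ := fun τ hτ => by
    have hVτ : V τ = 2 * ∫ x in Set.Ioc (0:ℝ) τ, (τ - x) * C x := congrFun hV τ
    rw [hVτ]
    show 2 * ∫ x in Set.Ioc (0:ℝ) τ, (τ - x) * C x = 2 * (τ * F τ - G τ)
    congr 1
    rw [← intervalIntegral.integral_of_le hτ]
    have e : (fun x : ℝ => (τ - x) * C x) = fun x : ℝ => τ * C x - x * C x := funext fun x => by ring
    rw [e, intervalIntegral.integral_sub ((hC.const_mul τ).intervalIntegrable _ _)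
      (hxC.intervalIntegrable _ _), intervalIntegral.integral_const_mul]
  -- adjacent-window identity: `W (s + t) - W s - W t = ∫₀ˢ (2 F (u + t) - 2 F u) du`
  have hΨd : ∀ u : ℝ, HasDerivAt (fun u : ℝ => W (u + t) - W u) (2 * F (u + t) - 2 * F u) u :=
    fun u => (HasDerivAt.comp_add_const u t (hWd (u + t))).sub (hWd u)
  have hΨc : Continuous fun u : ℝ => 2 * F (u + t) - 2 * F u :=
    (continuous_const.mul (hFc.comp (continuous_add_const t))).sub (continuous_const.mul hFc)
  have hkey : ∫ u in (0:ℝ)..s, (2 * F (u + t) - 2 * F u) = W (s + t) - W s - W t := by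
    rw [intervalIntegral.integral_eq_sub_of_hasDerivAt (fun u _ => hΨd u) (hΨc.intervalIntegrable _ _),
      zero_add, hW0, sub_zero]
  -- the `C`-window integrals in closed form, integrated over `u ∈ [0, s]`
  have hIC : ∫ u in (0:ℝ)..s, ∫ w in u..(u + t), C w = ∫ u in (0:ℝ)..s, (F (u + t) - F u) :=
    intervalIntegral.integral_congr fun u _ => window_integral_eq_primitive_sub hC u t
  have h2C : 2 * ∫ u in (0:ℝ)..s, ∫ w in u..(u + t), C w = W (s + t) - W s - W t := by
    rw [hIC, ← hkey, ← intervalIntegral.integral_const_mul]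
    exact intervalIntegral.integral_congr fun u _ => by ring
  -- window domination, integrated over `u ∈ [0, s]`
  have hmono : ∫ u in (0:ℝ)..s, -(∫ w in u..(u + t), K w) ≤ ∫ u in (0:ℝ)..s, ∫ w in u..(u + t), C w :=
    intervalIntegral.integral_mono_on hs ((continuous_window_integral hK t).neg.intervalIntegrable _ _)
      ((continuous_window_integral hC t).intervalIntegrable _ _)
      fun u hu => neg_window_integral_le hC hK hdom hu.1 ht
  rw [intervalIntegral.integral_neg] at hmono
  rw [hVW s hs, hVW t ht, hVW (s + t) (add_nonneg hs ht)]
  linarith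

end Summit.AtomisticToContinuum.FouriersLaw.Theorems.QuasiSuperadditiveHeatVariance.ReturnFlowBernstein

end
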